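import Summits.Ventures.PercRepro.ExcessOneClass

/-!
# The excess-one Lemma B at a tight trace containing `∅`: the case of a partner family that
does not cover the ground set

Setting (proofs/MINE1-theoremS.md, Addendum 22 and its supplements 4–5): `F` is a twin-free
family with no trivial element, `∅ ∉ F`, `|F \\ F| = |F| + 1`, and `r` is an element with `{r} ∈ F`
whose trace `P := proj r F` is tight; `K := partner r F` is nonempty and of excess one. Then

* `P` is a simplicial complex on twin-closed sets (convexity of a tight family between `∅` and a
  member), and contains every singleton;
* **`X = P`**: every member of the trace is a difference of `F` avoiding `r`
  (`diffsX_eq_proj_of_singleton_mem`), hence `|Y| = |K| + 1` and **`Y = K \\ K`**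
  (`diffsY_eq_diffs_partner`): every difference `t ∖ s` with `r ∈ t`-side `t` and `r ∉ s` is a
  difference of two partner members;
* consequently every member of `partr r F` lies inside `⋃ K` (`partr_subset_biUnion_partner`),
  and if some element `y ≠ r` lies in no partner member, then `{y}` is a member avoiding `r`,
  `t ↦ t \ {y}` is injective on `partr r F` with values in `Y`, and
  **`partr r F = insert ∅ (partner r F)`** (`partr_eq_insert_empty_partner_of_not_cover`): the
  excess-one Lemma B «`F₁ ⊆ F₀ ∪ {∅}`» holds at `r`.

These are steps (1), (2) and supplement 5 of Addendum 22; the remaining cases of the excess-one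
Lemma B (a partner family covering `S ∖ r`, or a tight partner family) are open there.
-/

namespace PercRepro.MSTight

open Finset
open scoped FinsetFamily

variable {α : Type*} [DecidableEq α] [Fintype α]

section ComplexTrace

variable {F : Finset (Finset α)} {r : α}

omit [Fintype α] in
/-- If `{r} ∈ F`, every member of the trace is a difference of `F` avoiding `r`: `X = proj r F`. -/
theorem diffsX_eq_proj_of_singleton_mem (hP : Tight (proj r F)) (hr : ({r} : Finset α) ∈ F) :
    diffsX r F = proj r F := by
  have h1 : proj r F ⊆ diffsX r F := by
    intro p hp
    obtain ⟨s, hs, rfl⟩ := mem_proj.1 hp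
    rw [mem_diffsX_iff]
    refine ⟨?_, notMem_erase r s⟩
    rw [erase_eq]
    exact sdiff_mem_diffs hs hr
  have h2 : diffsX r F ⊆ proj r F \\ proj r F := by
    rw [diffs_proj_eq]
    exact subset_union_left
  have h3 : (proj r F \\ proj r F).card ≤ (proj r F).card := by
    unfold Tight at hP
    omega
  exact (eq_of_subset_of_card_le h1 ((card_le_card h2).trans h3)).symm

omit [Fintype α] in
/-- With `{r} ∈ F` and a tight trace, `|Y| = |partner r F| + 1` when `|F \\ F| = |F| + 1`. -/
theorem card_diffsY_of_singleton_mem (hP : Tight (proj r F)) (hr : ({r} : Finset α) ∈ F)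
    (hF : (F \\ F).card = F.card + 1) :
    (diffsY r F).card = (partner r F).card + 1 := by
  have h1 := card_diffs_eq_card_X_add_card_Y r F
  have h2 := card_eq_card_proj_add_card_partner r F
  rw [diffsX_eq_proj_of_singleton_mem hP hr] at h1
  omega

omit [Fintype α] in
/-- With `{r} ∈ F`, a tight trace, `|F \\ F| = |F| + 1` and a partner family of excess one,
`Y = partner r F \\ partner r F`. -/
theorem diffsY_eq_diffs_partner (hP : Tight (proj r F)) (hr : ({r} : Finset α) ∈ F)
    (hF : (F \\ F).card = F.card + 1)
    (hK : (partner r F \\ partner r F).card = (partner r F).card + 1) :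
    diffsY r F = partner r F \\ partner r F := by
  have h1 : partner r F \\ partner r F ⊆ diffsY r F :=
    (diffs_partner_subset r F).trans inter_subset_right
  have h2 := card_diffsY_of_singleton_mem hP hr hF
  exact (eq_of_subset_of_card_le h1 (by omega)).symm

omit [Fintype α] in
/-- Every member of `partr r F` lies inside the union of the partner family (when `Y = K \\ K` and
the partner family is nonempty). -/
theorem partr_subset_biUnion_partner (hY : diffsY r F = partner r F \\ partner r F)
    (hne : (partner r F).Nonempty) {t : Finset α} (ht : t ∈ partr r F) :
    t ⊆ (partner r F).biUnion id := by
  intro x hx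
  by_contra hxK
  rw [mem_biUnion] at hxK
  push Not at hxK
  simp only [id_eq] at hxK
  -- `x` lies in every member avoiding `r`: otherwise `t \ s ∋ x` would be a difference of `K`
  have hall : ∀ s ∈ part0 r F, x ∈ s := by
    intro s hs
    by_contra hxs
    have hts : t \ s ∈ diffsY r F := sdiff_mem_diffs ht hs
    rw [hY] at hts
    obtain ⟨k, hk, k', -, hkk'⟩ := mem_diffs.1 hts
    have hxts : x ∈ t \ s := mem_sdiff.2 ⟨hx, hxs⟩
    rw [← hkk', mem_sdiff] at hxts
    exact hxK k hk hxts.1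
  obtain ⟨k, hk⟩ := hne
  exact hxK k hk (hall k (mem_inter.1 hk).1)

/-- **The excess-one Lemma B at a tight trace containing `∅`, when the partner family does not
cover the ground set.** Let `F` be twin-free without trivial elements, `∅ ∉ F`,
`|F \\ F| = |F| + 1`, `{r} ∈ F`, `proj r F` tight, `partner r F` nonempty of excess one, and let
`y ≠ r` lie in no partner member. Then `partr r F = insert ∅ (partner r F)`; in particular
`F₁ ⊆ F₀ ∪ {∅}`. -/
theorem partr_eq_insert_empty_partner_of_not_cover
    (htf : ∀ a b, Twin F a b → a = b) (hnt : ∀ a, ∃ t ∈ F, a ∈ t)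
    (hE : (∅ : Finset α) ∉ F) (hF : (F \\ F).card = F.card + 1)
    (hP : Tight (proj r F)) (hr : ({r} : Finset α) ∈ F) (hne : (partner r F).Nonempty)
    (hK : (partner r F \\ partner r F).card = (partner r F).card + 1)
    {y : α} (hy : y ≠ r) (hyK : ∀ k ∈ partner r F, y ∉ k) :
    partr r F = insert ∅ (partner r F) := by
  have hY := diffsY_eq_diffs_partner hP hr hF hK
  have hcardY := card_diffsY_of_singleton_mem hP hr hF
  -- `∅ ∈ partr r F`
  have h0 : (∅ : Finset α) ∈ partr r F := mem_partr.2 ⟨notMem_empty r, by simpa using hr⟩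
  -- the singleton `{y}` is a member of the trace (convexity between `∅` and a member containing `y`)
  have hyP : ({y} : Finset α) ∈ proj r F := by
    obtain ⟨t, ht, hyt⟩ := hnt y
    have htP : t.erase r ∈ proj r F := mem_proj.2 ⟨t, ht, rfl⟩
    have h0P : (∅ : Finset α) ∈ proj r F := by
      rw [proj_eq_union]
      exact mem_union_right _ h0
    refine mem_of_subset_of_subset_of_twinClosed_of_tight hP h0P htP (empty_subset _) ?_ ?_
    · intro z hz
      rw [mem_singleton] at hz
      subst hz
      exact mem_erase.2 ⟨hy, hyt⟩
    · intro a b hab ha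
      rw [mem_singleton] at ha ⊢
      rw [ha] at hab
      exact twin_proj_eq_of_twin_eq hy (fun b' hb' => (htf _ _ hb').symm) (hnt y) b hab
  -- `{y}` avoids `r` and is not in `partr r F`, hence lies in `part0 r F`
  have hy0 : ({y} : Finset α) ∈ part0 r F := by
    rw [proj_eq_union, mem_union] at hyP
    rcases hyP with h | h
    · exact h
    · exfalso
      have := partr_subset_biUnion_partner hY hne h (mem_singleton_self y)
      rw [mem_biUnion] at this
      obtain ⟨k, hk, hyk⟩ := this
      exact hyK k hk hyk
  -- `t ↦ t \ {y}` is the identity on `partr r F` and lands in `Y`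
  have hsub : partr r F ⊆ diffsY r F := by
    intro t ht
    have hyt : y ∉ t := fun h => by
      have := partr_subset_biUnion_partner hY hne ht h
      rw [mem_biUnion] at this
      obtain ⟨k, hk, hyk⟩ := this
      exact hyK k hk hyk
    have h : t \ {y} = t := sdiff_eq_self_iff_disjoint.2 (disjoint_singleton_right.2 hyt)
    rw [← h]
    exact sdiff_mem_diffs ht hy0
  have hle : (partr r F).card ≤ (partner r F).card + 1 := by
    have := card_le_card hsub
    omega
  -- `insert ∅ K ⊆ partr r F` has `|K| + 1` elements
  have hKsub : insert ∅ (partner r F) ⊆ partr r F := by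
    intro t ht
    rw [mem_insert] at ht
    rcases ht with rfl | ht
    · exact h0
    · exact (mem_inter.1 ht).2
  have h0K : (∅ : Finset α) ∉ partner r F := fun h => hE (mem_part0.1 (mem_inter.1 h).1).1
  have hcardK : (insert ∅ (partner r F)).card = (partner r F).card + 1 := card_insert_of_notMem h0K
  exact (eq_of_subset_of_card_le hKsub (by omega)).symm

end ComplexTrace

end PercRepro.MSTight
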